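import Summits.BirchSwinnertonDyer.BirchSwinnertonDyer.Theorems.SignedLowerHalvesSmallImageLowerHalfBothSignsRttD2SeqSemilocTowerPairing
import Summits.BirchSwinnertonDyer.BirchSwinnertonDyer.Theorems.SignedLowerHalvesSmallImageLowerHalfBothSignsRttD2SeqSemilocLocDict
import Summits.BirchSwinnertonDyer.BirchSwinnertonDyer.Theorems.SignedLowerHalvesSmallImageLowerHalfBothSignsRttJunctionLambdaLocImage
import HarnessLib

/-!
# Route `SignedLowerHalves`, crux L `SmallImageLowerHalfBothSigns` (stmt-BirchSwinnertonDyer-23599), line `rtt_w3` v30 — stub S3β″ (`stub_junctionPT_ns`, row J4′,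
# Poitou–Tate half), brick N2d (α): THE SEMILOCAL TOWER PAIRING AT `w` KILLS EVERY CLASS THAT IS LOCALLY TRIVIAL AT ALL PRIMES OF `K_∞` ABOVE `w` —
# in particular `⟨h, s⟩_{w,∞} = 0` for `s` in the strict Selmer group `Sel_{str at Σ}` and `w ∈ Σ`

WIDTH seat `bsd-line-slh-p3-w3` g26 under LEAD `cruxlead-stmt-BirchSwinnertonDyer-23599` g14 (cell `bsd-ssimc`); helper `--supports stmt-BirchSwinnertonDyer-23599`
(design memo `Lines/rtt_w3-DESIGN-S3beta-w3-g25.md`, rev 4 §6 RECIPE N2d (α)). PURE THEOREMS; no definition, no named fact, no instance, no `sorry`.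
HONEST FRAMING: this is the well-definedness of `Φ : H′ → (Sel_{str,v} ⧸ Sel_str)^∨` (brick N2 of S3β″: the semilocal tower pairing descends modulo `Sel_str`); nothing about S3β″,
S3α′, crux L or BSD is proved; all remain OPEN and are proved for NO curve.

THE ARGUMENT (★★★ `pairInf_eq_zero_of_forall_locAt_conjH1_eq_zero`). Let `s ∈ H¹(Gal(K̄/K_∞), M)` with `loc_w(conj_σ s) = 0` for all `σ ∈ Γ_K` (local triviality at every prime of `K_∞`
above `w`). Write `s = res_n(torsToH1 ℓ)`, `ℓ ∈ H¹(U_n, M[p^k])` (exhaustion twice). For each `σ`, `loc_{n,w}(conj_σ ℓ)` dies in `H¹(U_{∞,w}, M)`, hence (torsion kernel control on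
`U_{∞,w}`, then layer kernel control at `w` for `M[p^{k_σ}]`, g22 `exists_resOfLe_layer_eq_resOfLe_layer`) `res^{loc}_{n→N_σ}(torsIncl_{k→k_σ} loc_{n,w}(conj_σ ℓ)) = 0`. Only the
FINITELY many cosets `σ U_n` matter (`conj` of `U_n` is trivial on `H¹(U_n, ·)`), so one pair `(N, K)` works for all `σ`; then `ℓ′ := torsIncl_{k→K}(res_{n→N} ℓ)` still represents `s` and
ALL its conjugates are locally trivial at `w` at level `(N, K)`, so `semilocDual ℓ′ = 0` by Mackey (`…SemilocLocDict`), and `⟨h, s⟩_{w,∞} = ⟨proj_{N,K} h, semilocDual ℓ′⟩ / p^K = 0`.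
Corollary ★★ `pairInf_eq_zero_of_mem_strictSelmer` (`s ∈ Sel_{str at Σ}`, `w ∈ Σ`).
References: [SerreGaloisCohomology1997] I §2.2 Prop. 8, §2.5; [NeukirchSchmidtWingberg2008] I §6 (1.6.4)–(1.6.5), (8.6.2); [Rubin2000] Thm. 1.7.3, App. B.2–B.3; [Kobayashi2003] Thm. 7.3 i).
-/

set_option autoImplicit false
set_option linter.dupNamespace false -- D-0017: single-problem summit, the namespace repeats the problem name by design
noncomputable section

open scoped Classical
open CategoryTheory Function NumberField IsDedekindDomain Field

namespace Summit.BirchSwinnertonDyer.BirchSwinnertonDyer.Theorems.SmallImageRttD2Seq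

open Literature.NumberTheory.GaloisRepresentations Literature.NumberTheory.GaloisCohomology Literature.NumberTheory.EllipticCurves
  Literature.NumberTheory.ComplexMultiplication.EllipticUnits Literature.NumberTheory.ComplexMultiplication.EllipticUnits.JohnsonLeungKings2011
  Literature.NumberTheory.GaloisRepresentations.DiscreteGaloisModule Literature.NumberTheory.GaloisCohomology.PoitouTateFinite
  Literature.AnabelianGeometry.AbsoluteAnabelian.Prop121vii
  Summit.BirchSwinnertonDyer.BirchSwinnertonDyer.Theorems.SmallImageRttD2J1 Summit.BirchSwinnertonDyer.BirchSwinnertonDyer.Theorems.SmallImageCharSignedSelmer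

namespace SemilocIwasawaCohomologyDataO

section Vanishing

variable {K : Type} [Field K] [NumberField K] {p : ℕ} [Fact p.Prime] {S : Set (PadicAlgCl p)} [FiniteDimensional ℚ_[p] (padicCoeffField S)] {κ : ZpExtension K p}
  {γ : absoluteGaloisGroup K} {θ' : absoluteGaloisGroup K →ₜ* (padicCoeffIntegers S)ˣ} {P : Set (HeightOneSpectrum (𝓞 K))} {w : HeightOneSpectrum (𝓞 K)}
  (L : SemilocIwasawaCohomologyDataO S κ γ θ' P w 1)
  (M : Type) [AddCommGroup M] [TopologicalSpace M] [DiscreteTopology M] [DistribMulAction (absoluteGaloisGroup K) M]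
  (hstabK : ∀ m : M, IsOpen (MulAction.stabilizer (absoluteGaloisGroup K) m : Set (absoluteGaloisGroup K)))
  (PG : ∀ k : ℕ, ContPairing (coeffRepK S θ' P k).toTopRep (torsRep M hstabK p k).toTopRep (mu K (p ^ k)).toTopRep)
  (hPred : ∀ (k : ℕ) (x : ↥(Representation.invariants ((muTwistO S θ' (k + 1)).toRepresentation.comp (ramificationSubgroup K P).subtype))) (m : ↥(torsionPow M p k)),
    (PG (k + 1)).toLin x (AddSubgroup.inclusion (torsionPow_mono (M := M) (p := p) (Nat.le_succ k)) m) =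
      muInclusion K (pow_dvd_pow p (Nat.le_succ k)) ((PG k).toLin (coeffMapO S P θ' (oMuRed S k) (oMuRed_muTwistO S θ' k) x) m))
  (hM : ∀ m : M, ∃ k : ℕ, p ^ k • m = 0)

/-- **One conjugate at a time**: if `loc_w(conj_σ res_n(torsToH1 ℓ)) = 0` in `H¹(U_{∞,w}, M)`, then for some torsion level `k′ ≥ k` and some layer `N ≥ n` the local class
`res^{loc}_{n→N}(torsIncl_{k→k′}(loc_{n,w}(conj_σ ℓ)))` vanishes in `H¹(U_{N,w}, M[p^{k′}])` (torsion kernel control on `U_{∞,w}`, then layer kernel control at `w` for `M[p^{k′}]`).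
[cite: SerreGaloisCohomology1997, I §2.2 Prop. 8] [cite: Rubin2000, App. B.2] -/
theorem _root_.Summit.BirchSwinnertonDyer.BirchSwinnertonDyer.Theorems.SmallImageRttD2Seq.exists_resOfLe_torsIncl_locH1Layer_conjH1_eq_zero
    (hstabK : ∀ m : M, IsOpen (MulAction.stabilizer (absoluteGaloisGroup K) m : Set (absoluteGaloisGroup K))) (hM : ∀ m : M, ∃ k : ℕ, p ^ k • m = 0) (n k : ℕ) (ℓ : subgroupH1 (κ.layerSubgroup n) ↥(torsionPow M p k)) (σ : absoluteGaloisGroup K)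
    (hσ : locAt κ M w (conjH1 κ.kerSubgroup M σ (resOfLe M (κ.kerSubgroup_le_layerSubgroup n) (torsToH1 M p (κ.layerSubgroup n) k ℓ))) = 0) :
    letI := localAction (closureEmb (K := K) (w.adicCompletion K)) M
    ∃ (k' : ℕ) (hk : k ≤ k') (N : ℕ) (hnN : n ≤ N),
      resOfLe ↥(torsionPow M p k') (localSubgroupOfEmb_layerSubgroup_antitone κ w hnN)
        (torsIncl M p (localSubgroupOfEmb (κ.layerSubgroup n) (closureEmb (K := K) (w.adicCompletion K))) hk
          (locH1Layer κ ↥(torsionPow M p k) w (fun _ _ ↦ rfl) n (conjH1 (κ.layerSubgroup n) ↥(torsionPow M p k) σ ℓ))) = 0 := by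
  letI := localAction (closureEmb (K := K) (w.adicCompletion K)) M
  -- rewrite the hypothesis: `conj ∘ res = res ∘ conj`, `conj ∘ torsToH1 = torsToH1 ∘ conj`, `loc_w ∘ res_∞ = res^{loc}_∞ ∘ loc_{n,w}`, `loc ∘ torsToH1 = torsToH1 ∘ loc`,
  -- `res ∘ torsToH1 = torsToH1 ∘ res`
  have h1 : locH1 κ M w (fun _ _ ↦ rfl) (conjH1 κ.kerSubgroup M σ (resOfLe M (κ.kerSubgroup_le_layerSubgroup n) (torsToH1 M p (κ.layerSubgroup n) k ℓ))) = 0 := hσ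
  have hcomm := DFunLike.congr_fun (resOfLe_comp_conjH1_holds (M := M) (κ.kerSubgroup_le_layerSubgroup n) σ) (torsToH1 M p (κ.layerSubgroup n) k ℓ)
  rw [AddMonoidHom.comp_apply, AddMonoidHom.comp_apply] at hcomm
  rw [← hcomm, ← torsToH1_conjH1, locH1_resOfLe, locH1Layer_torsToH1 κ w M (fun _ _ ↦ rfl) (fun _ _ _ ↦ rfl), ← torsToH1_resOfLe] at h1
  -- torsion kernel control on `U_{∞,w}`
  obtain ⟨k', hk, h0⟩ := exists_torsIncl_eq_zero_of_torsToH1_eq_zero (localSubgroupOfEmb κ.kerSubgroup (closureEmb (K := K) (w.adicCompletion K))) hM k _ h1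
  rw [torsIncl_resOfLe] at h0
  -- layer kernel control at `w` for `M[p^{k'}]`
  have hstabT : ∀ m : ↥(torsionPow M p k'), IsOpen (MulAction.stabilizer (absoluteGaloisGroup (w.adicCompletion K)) m : Set (absoluteGaloisGroup (w.adicCompletion K))) :=
    isOpen_stabilizer_of_hres ↥(torsionPow M p k') w (fun _ _ ↦ rfl) (isOpen_stabilizer_torsionPow hstabK p k')
  obtain ⟨N, hnN, hnN', hN⟩ := exists_resOfLe_layer_eq_resOfLe_layer (κ := κ) (v := w) hstabT
    (torsIncl M p (localSubgroupOfEmb (κ.layerSubgroup n) (closureEmb (K := K) (w.adicCompletion K))) hk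
      (locH1Layer κ ↥(torsionPow M p k) w (fun _ _ ↦ rfl) n (conjH1 (κ.layerSubgroup n) ↥(torsionPow M p k) σ ℓ)))
    (0 : subgroupH1 (localSubgroupOfEmb (κ.layerSubgroup n) (closureEmb (K := K) (w.adicCompletion K))) ↥(torsionPow M p k')) (by rw [map_zero]; exact h0)
  exact ⟨k', hk, N, hnN, by rw [hN, map_zero]⟩

/-- ★★★ **THE SEMILOCAL TOWER PAIRING AT `w` KILLS THE CLASSES THAT ARE LOCALLY TRIVIAL AT EVERY PRIME OF `K_∞` ABOVE `w`.** For `h ∈ 𝐇¹_{Iw,w}` and `s ∈ H¹(Gal(K̄/K_∞), M)` with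
`loc_w(conj_σ s) = 0` for ALL `σ ∈ Γ_K`: `⟨h, s⟩_{w,∞} = 0`. (See the module docstring: finitely many cosets `σ U_n`, one common deeper level `(N, K)`, Mackey.)
[cite: NeukirchSchmidtWingberg2008, I §6 (1.6.4)–(1.6.5), (8.6.2)] [cite: SerreGaloisCohomology1997, I §2.2 Prop. 8] [cite: Rubin2000, Thm. 1.7.3, App. B.3] -/
theorem pairInf_eq_zero_of_forall_locAt_conjH1_eq_zero (h : L.H) (s : subgroupH1 κ.kerSubgroup M)
    (hs : ∀ σ : absoluteGaloisGroup K, locAt κ M w (conjH1 κ.kerSubgroup M σ s) = 0) :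
    L.pairInf M hstabK PG hPred hM h s = 0 := by
  letI := localAction (closureEmb (K := K) (w.adicCompletion K)) M
  obtain ⟨n, c, rfl⟩ := exists_resOfLe_globalLayer_eq (κ := κ) hstabK s
  haveI := compactSpace_layerSubgroup κ n
  obtain ⟨k, ℓ, rfl⟩ := exists_torsToH1_eq (κ.layerSubgroup n) hM c
  -- per-`σ` data, then one common level for the finitely many cosets of `U_n`
  have step := fun σ ↦ exists_resOfLe_torsIncl_locH1Layer_conjH1_eq_zero M hstabK hM n k ℓ σ (hs σ)
  choose kf hkf Nf hNf hstep using step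
  letI := layerQuotFintype κ n
  obtain ⟨K', hK'⟩ : ∃ K' : ℕ, ∀ q : absoluteGaloisGroup K ⧸ κ.layerSubgroup n, kf q.out ≤ K' :=
    ⟨(Finset.univ : Finset (absoluteGaloisGroup K ⧸ κ.layerSubgroup n)).sup fun q : absoluteGaloisGroup K ⧸ κ.layerSubgroup n ↦ kf q.out,
      fun q ↦ Finset.le_sup (f := fun q : absoluteGaloisGroup K ⧸ κ.layerSubgroup n ↦ kf q.out) (Finset.mem_univ q)⟩
  obtain ⟨N', hN'⟩ : ∃ N' : ℕ, ∀ q : absoluteGaloisGroup K ⧸ κ.layerSubgroup n, Nf q.out ≤ N' :=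
    ⟨(Finset.univ : Finset (absoluteGaloisGroup K ⧸ κ.layerSubgroup n)).sup fun q : absoluteGaloisGroup K ⧸ κ.layerSubgroup n ↦ Nf q.out,
      fun q ↦ Finset.le_sup (f := fun q : absoluteGaloisGroup K ⧸ κ.layerSubgroup n ↦ Nf q.out) (Finset.mem_univ q)⟩
  have hkK : k ≤ K' := (hkf _).trans (hK' ((1 : absoluteGaloisGroup K) : absoluteGaloisGroup K ⧸ κ.layerSubgroup n))
  have hnN : n ≤ N' := (hNf _).trans (hN' ((1 : absoluteGaloisGroup K) : absoluteGaloisGroup K ⧸ κ.layerSubgroup n))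
  -- the new representative `ℓ' = torsIncl_{k→K'} (res_{n→N'} ℓ)`
  set ℓ' := torsIncl M p (κ.layerSubgroup N') hkK (resOfLe ↥(torsionPow M p k) (κ.layerSubgroup_antitone hnN) ℓ) with hℓ'
  have hrep : resOfLe M (κ.kerSubgroup_le_layerSubgroup n) (torsToH1 M p (κ.layerSubgroup n) k ℓ) =
      resOfLe M (κ.kerSubgroup_le_layerSubgroup N') (torsToH1 M p (κ.layerSubgroup N') K' ℓ') := by
    have hc := DFunLike.congr_fun (resOfLe_comp_holds (M := M) (κ.kerSubgroup_le_layerSubgroup N') (κ.layerSubgroup_antitone hnN)) (torsToH1 M p (κ.layerSubgroup n) k ℓ)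
    rw [AddMonoidHom.comp_apply] at hc
    rw [hℓ', torsToH1_torsIncl, torsToH1_resOfLe, hc]
  -- all conjugates of `ℓ'` are locally trivial at `w` at level `(N', K')`
  have hloc : ∀ δ : absoluteGaloisGroup K,
      locH1Layer κ ↥(torsionPow M p K') w (fun _ _ ↦ rfl) N' (conjH1 (κ.layerSubgroup N') ↥(torsionPow M p K') δ ℓ') = 0 := by
    intro δ
    set σ := ((δ : absoluteGaloisGroup K ⧸ κ.layerSubgroup n)).out with hσdef
    have hσδ : σ⁻¹ * δ ∈ κ.layerSubgroup n := QuotientGroup.eq.mp (QuotientGroup.out_eq' (δ : absoluteGaloisGroup K ⧸ κ.layerSubgroup n))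
    have hcomm := DFunLike.congr_fun (resOfLe_comp_conjH1_holds (M := ↥(torsionPow M p k)) (κ.layerSubgroup_antitone hnN) δ) ℓ
    rw [AddMonoidHom.comp_apply, AddMonoidHom.comp_apply] at hcomm
    rw [hℓ', ← torsIncl_conjH1', ← hcomm, conjH1_eq_conjH1_of_inv_mul_mem ↥(torsionPow M p k) (κ.layerSubgroup n) hσδ,
      locH1Layer_torsIncl κ w M (fun _ _ _ ↦ rfl), locH1Layer_resOfLe κ w ↥(torsionPow M p k) (fun _ _ ↦ rfl) hnN,
      ← torsIncl_torsIncl (localSubgroupOfEmb (κ.layerSubgroup N') (closureEmb (K := K) (w.adicCompletion K))) (hkf σ) (hK' _),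
      torsIncl_resOfLe, ← AddMonoidHom.comp_apply (resOfLe ↥(torsionPow M p (kf σ)) _),
      ← resOfLe_comp_holds (M := ↥(torsionPow M p (kf σ))) (localSubgroupOfEmb_layerSubgroup_antitone κ w (hN' _)) (localSubgroupOfEmb_layerSubgroup_antitone κ w (hNf σ)),
      AddMonoidHom.comp_apply, AddMonoidHom.comp_apply, hstep σ, map_zero, map_zero]
  rw [hrep, pairInf_apply_resOfLe_torsToH1]
  exact semilocPairNKQ_eq_zero_of_forall_locH1Layer_conjH1_eq_zero S κ θ' P M hstabK PG w N' K' (L.proj N' K' h) ℓ' hloc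

/-- ★★ **`Φ` DESCENDS MODULO THE STRICT SELMER GROUP**: for `s ∈ Sel_{str at Σ}(K_∞)` (lambda-p1's `strictSelmer … Σ`, p807576: locally trivial at every prime of `K_∞` above `Σ`) and
`w ∈ Σ`, `⟨h, s⟩_{w,∞} = 0` for every `h ∈ 𝐇¹_{Iw,w}`. [cite: Kobayashi2003, Thm. 7.3 i)] [cite: Rubin2000, Thm. 1.7.3] -/
theorem pairInf_eq_zero_of_mem_strictSelmer {R : Type*} [Ring R] [Module R M] (V : WeierstrassCurve K) (j : V.geomPrimaryTorsion p →+ M) (S₀ : Set (HeightOneSpectrum (𝓞 K))) (ε : ℤˣ)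
    {S₁ : Set (HeightOneSpectrum (𝓞 K))} (hw : w ∈ S₁) (h : L.H) {s : signedTransportSelmerInftySat κ M R V j S₀ ε} (hs : s ∈ strictSelmer κ M R V j S₀ ε S₁) :
    L.pairInf M hstabK PG hPred hM h (s : subgroupH1 κ.kerSubgroup M) = 0 :=
  L.pairInf_eq_zero_of_forall_locAt_conjH1_eq_zero M hstabK PG hPred hM h s fun σ ↦ (mem_strictSelmer_iff κ M R V j S₀ ε S₁ s).1 hs w hw σ

end Vanishing

end SemilocIwasawaCohomologyDataO

end Summit.BirchSwinnertonDyer.BirchSwinnertonDyer.Theorems.SmallImageRttD2Seq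

end
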